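/-
Copyright (c) 2026. All rights reserved.
Released under Apache 2.0 license as described in the file LICENSE.
Authors: abc-iut cell, statement-typer seat abc-iut-L4-t3 (wave 1; gen 8).
-/
import Literature.AnabelianGeometry.AbsoluteAnabelian.Ltimes.LogFrobeniusIotaAnMono
import Literature.AnabelianGeometry.AbsoluteAnabelian.LogFrobeniusIotaEtaSquare
import HarnessLib

/-!
# [AbsTopIII] Corollary 5.10 (iv)(c), interface add-on: the `η⊢`-naturality square along the edges of `Γ⃗×_v`

S. Mochizuki, *Topics in absolute anabelian geometry III: global reconstruction algorithms*,
J. Math. Sci. Univ. Tokyo 22 (2015) 939–1156 [MochizukiAbsTopIII2015]; locators `p.N` = pages of the author's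
manuscript (`paper:url-5493eb38cbb7`), read on the page (own render): Cor 5.10 (iv)(c) p. 148 l. 9–51 ("there is a
natural isomorphism `η⊢_{v,ν}` from the composite functor determined by the path `γ¹_{v,ν}` [of length 6]
`𝒳 →(λ⊞_{v,ν}) 𝒩⊞_v → 𝒩_v → ℰ• → ℰ⊢ → An⊢[𝒩⊢⊞] →(φ^{An⊢⊞}_{v,ν}) 𝒩⊢⊞_v` … to the composite functor determined by the
path `γ⁰_{v,ν}` [of length 2] `𝒳 →(λ⊞_{v,ν}) 𝒩⊞_v → 𝒩⊢⊞_v` … Moreover, the resulting homotopies `η⊢_{v,ν}`, `(η⊢_{v,ν})⁻¹`,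
together with the mono-analyticization homotopies and the homotopies on `D_{An⊢}` arising from the `ι^{An⊢⊞}_{v,ε}`
[cf. Proposition 5.8, (vii)], generate a contact structure `ℋ_{An⊢}` on `𝔗_{An⊢}` that is compatible with … the
homotopies of the observables `S_log`, `S_log⊞` of Corollary 5.5, (iii), that arise from the `ι⊞_{v,ε}`, `ι_{v,ε}` indexed
by `ε ∈ Γ⃗×_v` [not `Γ⃗^log_v`!]"); Def 3.5 (ii) p. 75 l. 6–31 (a family of homotopies carries ONE natural
transformation `ζ_ϖ` per pair `ϖ` of its saturated boundary set, `ζ_{ϖ″} = ζ_{ϖ′} ∘ ζ_ϖ`, `ζ_{ϖ′} = D[γ₃] ∘ ζ_ϖ ∘ D[γ₄]`;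
"compatible" = contained in ONE family of homotopies); §0 p. 26 l. 29–38 (saturated = (c) transitive, (d), (e) closed
under pre- and post-composition with paths); Def 5.4 (iii) p. 126, (v) p. 127 (`Γ⃗×_v = Γ⃗^⋉_v ∩ Γ⃗^⋊_v`), (vii) p. 128
(`ι⊞_{v,ε} : λ⊞_{v,ν₁} ∘ Λ_{ν₁} → λ⊞_{v,ν₂}`, `Λ_ν = id` at a pre-log vertex); Prop 5.8 (vii) p. 142 l. 11–17 (`ι^{An⊢⊞}_{w,ε}`).

WHY THIS FILE (interface ADD-ON, successor never in place; the FROZEN `LogFrobeniusCompatibility.lean` is NOT edited;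
same doctrine as `IotaOver` / `MonoTelecoreCoherence` / `IotaAnMono` of this lineage; L4-lead GO «IOTA-ETA-SQUARE»,
"the data half of F-0139″").  The coherence add-on `MonoTelecoreCoherence {psiOver, eta, eta_over}` records the printed
`η⊢_{v,ν}` vertex by vertex, the add-on `IotaAnMono {ι, ι_over}` records the `ι^{An⊢⊞}_{v,ε}` edge by edge, and print ties
them together through ONE clause: the homotopies generated by `η⊢`, `ι^{An⊢⊞}` and the `ι⊞`-homotopies of `S_log⊞`
(indexed by `ε ∈ Γ⃗×_v`) lie in ONE family of homotopies.  By Def 3.5 (ii) / §0 such a family carries exactly one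
homotopy per boundary pair of a saturated set, so the two composite homotopies `γ¹_{v,ν₁} ⇒ γ⁰_{v,ν₂}` along an edge
`ε : ν₁ → ν₂` of `Γ⃗×_v` — `η⊢_{v,ν₁}` then the post-composite of the `ι⊞_{v,ε}`-homotopy with `𝒩⊞_v → 𝒩⊢⊞_v` ((e), (c)), or
the homotopy `γ¹_{v,ν₁} ⇒ γ¹_{v,ν₂}` induced by `ι⊞_{v,ε}` and `ι^{An⊢⊞}_{v,ε}` ((d), (e), (c)) then `η⊢_{v,ν₂}` — must AGREE.
This file types that necessary condition, assumption-free, as a `Prop` on the data: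

* `LogFrobeniusSetting.iotaPre` / `iotaCore` — `ι⊞_{v,ε}` at a pre-log source (every vertex of `Γ⃗×_v` is pre-log) with
  the identity twist `Λ_{ν₁} = 𝟭` cast away: a plain natural transformation `λ⊞_{v,ν₁} ⟶ λ⊞_{v,ν₂}`, componentwise `HEq` to
  the interface field (so it instantiates the `m`-binders of abc-iut-f-101's `IotaSquaresCommute`);
* `gammaZeroApp L v ε hε y` — the homotopy `γ⁰_{v,ν₁} ⇒ γ⁰_{v,ν₂}` at `y` (`ι⊞_{v,ε,y}` mono-analyticised);
  `IotaAnMono.gammaOneApp I v ε hε y` — the homotopy `γ¹_{v,ν₁} ⇒ γ¹_{v,ν₂}` at `y` induced by `(ι⊞_{v,ε}, ι^{An⊢⊞}_{v,ε})`;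
* ★ `IotaAnMono.EtaNaturalAt I η` and `MonoTelecoreCoherence.EtaNatural K I` — **the square**
  `η⊢_{v,ν₁,y} ≫ gammaZeroApp = gammaOneApp ≫ η⊢_{v,ν₂,y}` for every `v`, every edge `ε : ν₁ → ν₂` of `Γ⃗×_v`, every `y`;
* consequences: `etaNaturalAt_iff_conj` (on the image of `γ¹` the `ι^{An⊢⊞}`-induced homotopy IS the `η⊢`-conjugate of
  the mono-analyticised `ι⊞`), `eta_app_eq_of_mono` (`η⊢_{v,·}` at the source of an edge of `Γ⃗×_v` is determined by its
  value at the target whenever the mono-analyticised `ι⊞_{v,ε}` is monic — hence, `Γ⃗×_v` being connected with sink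
  `(k̄^×)^pf` resp. `k^×`, by its value at the sink), `gammaOneApp_comp_eq` (Def 5.4 (iii)'s commutativity of the
  `ι⊞`-square of `Γ⃗×_non` transfers to the `γ¹`-side homotopies);
* non-vacuity, DEGENERATE and labelled so: at the TAGGED calibration setting (`tagged`; every `η⊢` an identity;
  `MonoTelecoreCoherence` inhabited by `taggedMonoTelecoreCoherence`) the `ι^{An⊢⊞}`-data `(𝟙, tag ν₁ ≤ tag ν₂)`
  (`taggedIotaAnMono`; NOT invertible along `𝒪^× ↪ k̄^×`, `taggedIotaAnMono_not_isIso`) satisfies the square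
  (`tagged_etaNatural`).  NO instance is placed at the genuine `nonarchGenuineMonoAn`: abc-iut-f-101 showed
  `MonoTelecoreCoherence` EMPTY there (augmentation not open), so it would be vacuous; the genuine instance belongs on
  the open-augmentation setting (E-L4-16) when it lands.

NOT HERE (successor, on GO only): the strengthened pinned row F-0139″ itself (the contact structure `ℋ_{An⊢}` WITH the
`ι^{An⊢⊞}`-generators and its compatibility with `S_log`, `S_log⊞` as ONE family on `D_{An⊢}`), of which `EtaNatural` is the
edge-indexed coherence datum.  ASSUMPTION-FREE typing of a printed compatibility; refereed pre-IUT material; nothing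
here bears on [IUTchIII] Cor. 3.12; OUR kernel typing, no side taken; typed ≠ proved.

**`⋉`-TWIN (cell row «LTIMES-SUCCESSOR», L4-lead m162; typing finding T3g9-F1).**  This file is the verbatim
re-elaboration of `LogFrobeniusIotaEtaSquare.lean` over the successor interface `LogFrobeniusSettingLtimes`
(`Ltimes/LogFrobeniusCompatibility.lean`: `ι⊞_{v,ε}` indexed by the edges of `Γ⃗^⋉_v` at EVERY place, [AbsTopIII] Cor 5.5 (iii)
p. 131), produced by the cell recipe `LTIMES-RECIPE.md`: names carry over inside `namespace LogFrobeniusSettingLtimes`, the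
section variable is `Lt`, setting-independent declarations are NOT repeated (the originals are in scope), statements and
proofs are otherwise unchanged.  The original file over the frozen interface stays as it is.
-/

set_option autoImplicit false

universe u

open CategoryTheory

namespace Literature.AnabelianGeometry.AbsoluteAnabelian

/-! ## The edges of `Γ⃗×_v` carry `ι⊞_{v,ε}` -/

/-- An edge of `Γ⃗×_v = Γ⃗^⋉_v ∩ Γ⃗^⋊_v` is an edge of `Γ⃗^⋉_v`, the graph along whose edges Def 5.4 (vii) provides `ι⊞_{v,ε}`.
[cite: MochizukiAbsTopIII2015, Def 5.4 (iii) p. 126] -/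
def LogEdgeTS.InCore.toLogEdgeLtimes :
    ∀ {b : Bool} {ν₁ ν₂ : LogVertex b} {ε : LogEdgeTS b ν₁ ν₂}, ε.InCore → LogEdgeLtimes b ν₁ ν₂
  | true, _, _, ε, h => ⟨ε, h.1⟩
  | false, _, _, ε, h => ⟨ε, h.1⟩

/-- Forgetting back to `Γ⃗^log_v` returns the edge. [cite: MochizukiAbsTopIII2015, Def 5.4 (iii) p. 126] -/
theorem LogEdgeTS.InCore.toLogEdgeLtimes_toTS :
    ∀ {b : Bool} {ν₁ ν₂ : LogVertex b} {ε : LogEdgeTS b ν₁ ν₂} (hε : ε.InCore), hε.toLogEdgeLtimes.toTS = ε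
  | true, _, _, _, _ => rfl
  | false, _, _, _, _ => rfl

namespace LogFrobeniusSettingLtimes

variable {Vmod : Type u} {isArc : Vmod → Bool} (Lt : LogFrobeniusSettingLtimes Vmod isArc)

/-! ## `ι⊞_{v,ε}` at a pre-log source, untwisted -/

/-- At a pre-log vertex `Λ_ν` is the identity functor (Def 5.4 (vii)), so the source `λ⊞_{v,ν} ∘ Λ_ν` of `ι⊞_{v,ε}` IS `λ⊞_{v,ν}`.
[cite: MochizukiAbsTopIII2015, Def 5.4 (vii) p. 128] -/
theorem twist_comp_lam_eq (v : Vmod) (ν : LogVertex (isArc v)) (h : ν.isPostLog = false) :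
    frobeniusTwist Lt.log ν.isPostLog ⋙ Lt.lam v ν = Lt.lam v ν := by
  rw [h, frobeniusTwist_false]
  exact Functor.id_comp _

/-- **`ι⊞_{v,ε}` at a pre-log source as a natural transformation `λ⊞_{v,ν₁} ⟶ λ⊞_{v,ν₂}`** (the identity twist `Λ_{ν₁} = 𝟭`
cast away by the canonical identification `twist_comp_lam_eq`). [cite: MochizukiAbsTopIII2015, Def 5.4 (vii) p. 128] -/
def iotaPre (v : Vmod) {ν₁ ν₂ : LogVertex (isArc v)} (ε : LogEdgeLtimes (isArc v) ν₁ ν₂) (h₁ : ν₁.isPostLog = false) :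
    Lt.lam v ν₁ ⟶ Lt.lam v ν₂ :=
  eqToHom (Lt.twist_comp_lam_eq v ν₁ h₁).symm ≫ Lt.iota v ε

/-- Componentwise: the untwisted component is the interface component after the canonical cast of its source.
[cite: MochizukiAbsTopIII2015, Def 5.4 (vii) p. 128] -/
theorem iotaPre_app (v : Vmod) {ν₁ ν₂ : LogVertex (isArc v)} (ε : LogEdgeLtimes (isArc v) ν₁ ν₂)
    (h₁ : ν₁.isPostLog = false) (y : Lt.X) :
    (Lt.iotaPre v ε h₁).app y =
      eqToHom (congrArg (fun F => F.obj y) (Lt.twist_comp_lam_eq v ν₁ h₁).symm) ≫ (Lt.iota v ε).app y := by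
  rw [iotaPre, NatTrans.comp_app, eqToHom_app]

/-- The untwisted component is `HEq` to the interface component `ι⊞_{v,ε,y}` (the form in which abc-iut-f-101's
`IotaSquaresCommute` / `iota_comp_eq_of_cor55Observables` bind the `ι⊞`-components).
[cite: MochizukiAbsTopIII2015, Def 5.4 (vii) p. 128] -/
theorem iotaPre_app_heq (v : Vmod) {ν₁ ν₂ : LogVertex (isArc v)} (ε : LogEdgeLtimes (isArc v) ν₁ ν₂)
    (h₁ : ν₁.isPostLog = false) (y : Lt.X) : HEq ((Lt.iotaPre v ε h₁).app y) ((Lt.iota v ε).app y) := by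
  refine (conj_eqToHom_iff_heq _ _ (congrArg (fun F => F.obj y) (Lt.twist_comp_lam_eq v ν₁ h₁).symm) rfl).mp ?_
  rw [iotaPre_app, eqToHom_refl, Category.comp_id]

/-- Conversely any plain morphism `λ⊞_{v,ν₁}(y) ⟶ λ⊞_{v,ν₂}(y)` that is `HEq` to `ι⊞_{v,ε,y}` IS the untwisted component (so
statements binding such an `m`, as abc-iut-f-101's, are statements about `iotaPre`).
[cite: MochizukiAbsTopIII2015, Def 5.4 (vii) p. 128] -/
theorem eq_iotaPre_app_of_heq (v : Vmod) {ν₁ ν₂ : LogVertex (isArc v)} (ε : LogEdgeLtimes (isArc v) ν₁ ν₂)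
    (h₁ : ν₁.isPostLog = false) (y : Lt.X) (m : (Lt.lam v ν₁).obj y ⟶ (Lt.lam v ν₂).obj y)
    (hm : HEq m ((Lt.iota v ε).app y)) : m = (Lt.iotaPre v ε h₁).app y := by
  rw [(conj_eqToHom_iff_heq m _ (congrArg (fun F => F.obj y) (Lt.twist_comp_lam_eq v ν₁ h₁).symm) rfl).mpr hm,
    iotaPre_app, eqToHom_refl, Category.comp_id]

/-- If the interface field `ι⊞_{v,ε}` is presented as the canonical cast followed by a plain `P : λ⊞_{v,ν₁} ⟶ λ⊞_{v,ν₂}` (the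
shape in which the tree's model settings define their `ι⊞`), the untwisted transformation IS `P`.
[cite: MochizukiAbsTopIII2015, Def 5.4 (vii) p. 128] -/
theorem iotaPre_eq_of_iota_eq (v : Vmod) {ν₁ ν₂ : LogVertex (isArc v)} (ε : LogEdgeLtimes (isArc v) ν₁ ν₂)
    (h₁ : ν₁.isPostLog = false) (P : Lt.lam v ν₁ ⟶ Lt.lam v ν₂)
    (hP : Lt.iota v ε = eqToHom (Lt.twist_comp_lam_eq v ν₁ h₁) ≫ P) : Lt.iotaPre v ε h₁ = P := by
  rw [iotaPre, hP, eqToHom_trans_assoc, eqToHom_refl, Category.id_comp]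

/-- **`ι⊞_{v,ε}` along an edge of `Γ⃗×_v`** (its source is a vertex of `Γ⃗×_v`, hence pre-log): `λ⊞_{v,ν₁} ⟶ λ⊞_{v,ν₂}`.
[cite: MochizukiAbsTopIII2015, Def 5.4 (vii) p. 128] -/
abbrev iotaCore (v : Vmod) {ν₁ ν₂ : LogVertex (isArc v)} (ε : LogEdgeTS (isArc v) ν₁ ν₂) (hε : ε.InCore) :
    Lt.lam v ν₁ ⟶ Lt.lam v ν₂ :=
  Lt.iotaPre v hε.toLogEdgeLtimes hε.isCross_src.1

/-! ## The homotopies `γ⁰_{v,ν₁} ⇒ γ⁰_{v,ν₂}` and `γ¹_{v,ν₁} ⇒ γ¹_{v,ν₂}` along an edge of `Γ⃗×_v` -/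

/-- **The homotopy `γ⁰_{v,ν₁} ⇒ γ⁰_{v,ν₂}` at `y`** along an edge `ε : ν₁ → ν₂` of `Γ⃗×_v`: the `ι⊞_{v,ε}`-homotopy of `S_log⊞`
post-composed with `𝒩⊞_v → 𝒩⊢⊞_v` (§0 (e), Def 3.5 (ii) `ζ_{ϖ′} = D[γ₃] ∘ ζ_ϖ`), i.e. `ι⊞_{v,ε,y}` mono-analyticised.
[cite: MochizukiAbsTopIII2015, Cor 5.10 (iv)(c) p. 148] -/
def gammaZeroApp (v : Vmod) {ν₁ ν₂ : LogVertex (isArc v)} (ε : LogEdgeTS (isArc v) ν₁ ν₂) (hε : ε.InCore)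
    (y : Lt.X) : (Lt.lam v ν₁ ⋙ Lt.monoNplus v).obj y ⟶ (Lt.lam v ν₂ ⋙ Lt.monoNplus v).obj y :=
  (Lt.monoNplus v).map ((Lt.iotaCore v ε hε).app y)

namespace IotaAnMono

variable {Lt}
variable {hψ : ∀ (w : Vmod) (j : {ν : LogVertex (isArc w) // ν.IsCross}),
  Lt.ψAnMono w j ⋙ Lt.forgetMono w ⋙ Lt.toEmono w ≅ Lt.κAnMono.inverse}
variable (I : Lt.IotaAnMono hψ)

/-- **The homotopy `γ¹_{v,ν₁} ⇒ γ¹_{v,ν₂}` at `y` along an edge `ε : ν₁ → ν₂` of `Γ⃗×_v`** lying in any family of homotopies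
that contains the `ι⊞_{v,ε}`-homotopy of `S_log⊞` and the `ι^{An⊢⊞}_{v,ε}`-homotopy (§0 (d), (e); Def 3.5 (ii)
`ζ_{ϖ′} = D[γ₃] ∘ ζ_ϖ ∘ D[γ₄]`, `ζ_{ϖ″} = ζ_{ϖ′} ∘ ζ_ϖ`): `ι⊞_{v,ε,y}` transported along
`𝒩⊞_v → 𝒩_v → ℰ• → ℰ⊢ ⥲ An⊢[𝒩⊢⊞] →(ψ^{An⊢⊞}_{v,ν₁})`, followed by `ι^{An⊢⊞}_{v,ε}` at the transport of `λ⊞_{v,ν₂}(y)`.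
[cite: MochizukiAbsTopIII2015, Cor 5.10 (iv)(c) p. 148] -/
def gammaOneApp (v : Vmod) {ν₁ ν₂ : LogVertex (isArc v)} (ε : LogEdgeTS (isArc v) ν₁ ν₂) (hε : ε.InCore)
    (y : Lt.X) :
    (Lt.lam v ν₁ ⋙ Lt.forget v ⋙ Lt.toE v ⋙ Lt.monoAn ⋙ Lt.κAnMono.functor ⋙ Lt.ψAnMono v ⟨ν₁, hε.isCross_src⟩).obj y ⟶
      (Lt.lam v ν₂ ⋙ Lt.forget v ⋙ Lt.toE v ⋙ Lt.monoAn ⋙ Lt.κAnMono.functor ⋙ Lt.ψAnMono v ⟨ν₂, hε.isCross_tgt⟩).obj y :=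
  (Lt.ψAnMono v ⟨ν₁, hε.isCross_src⟩).map
      ((Lt.forget v ⋙ Lt.toE v ⋙ Lt.monoAn ⋙ Lt.κAnMono.functor).map ((Lt.iotaCore v ε hε).app y)) ≫
    (I.ι v ε hε).app ((Lt.lam v ν₂ ⋙ Lt.forget v ⋙ Lt.toE v ⋙ Lt.monoAn ⋙ Lt.κAnMono.functor).obj y)

/-- `ι`-first form (naturality of `ι^{An⊢⊞}_{v,ε}`): first `ι^{An⊢⊞}_{v,ε}` at the transport of `λ⊞_{v,ν₁}(y)`, then `ι⊞_{v,ε,y}`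
transported along `… →(ψ^{An⊢⊞}_{v,ν₂})`. [cite: MochizukiAbsTopIII2015, Cor 5.10 (iv)(c) p. 148] -/
theorem gammaOneApp_eq_iota_first (v : Vmod) {ν₁ ν₂ : LogVertex (isArc v)} (ε : LogEdgeTS (isArc v) ν₁ ν₂)
    (hε : ε.InCore) (y : Lt.X) :
    I.gammaOneApp v ε hε y =
      (I.ι v ε hε).app ((Lt.lam v ν₁ ⋙ Lt.forget v ⋙ Lt.toE v ⋙ Lt.monoAn ⋙ Lt.κAnMono.functor).obj y) ≫
        (Lt.ψAnMono v ⟨ν₂, hε.isCross_tgt⟩).map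
          ((Lt.forget v ⋙ Lt.toE v ⋙ Lt.monoAn ⋙ Lt.κAnMono.functor).map ((Lt.iotaCore v ε hε).app y)) :=
  (I.ι v ε hε).naturality _

/-! ## The square -/

/-- **[AbsTopIII] Cor 5.10 (iv)(c), the `η⊢`-naturality square along the edges of `Γ⃗×_v`** for `ι^{An⊢⊞}`-data `I` and a
family `η` of the printed type of the `η⊢_{v,ν}` (the binder `hη` of abc-iut-f-101's sufficiency files): for every
`v ∈ V(F_mod)`, every edge `ε : ν₁ → ν₂` of `Γ⃗×_v` and every object `y` of `Th•_T[Z]`,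
`η⊢_{v,ν₁,y} ≫ gammaZeroApp = gammaOneApp ≫ η⊢_{v,ν₂,y}` — the two composite homotopies `γ¹_{v,ν₁} ⇒ γ⁰_{v,ν₂}` coincide, as
they must in ONE family of homotopies containing `η⊢`, the `ι^{An⊢⊞}`-homotopies and the `ι⊞`-homotopies of `S_log⊞`
(Def 3.5 (ii): one `ζ_ϖ` per boundary pair).  A CONDITION on the data, not a consequence of the interface.
[cite: MochizukiAbsTopIII2015, Cor 5.10 (iv)(c) p. 148] -/
def EtaNaturalAt
    (η : ∀ (v : Vmod) (ν : LogVertex (isArc v)) (hν : ν.IsCross),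
      Lt.lam v ν ⋙ Lt.forget v ⋙ Lt.toE v ⋙ Lt.monoAn ⋙ Lt.κAnMono.functor ⋙ Lt.ψAnMono v ⟨ν, hν⟩ ≅
        Lt.lam v ν ⋙ Lt.monoNplus v) : Prop :=
  ∀ (v : Vmod) ⦃ν₁ ν₂ : LogVertex (isArc v)⦄ (ε : LogEdgeTS (isArc v) ν₁ ν₂) (hε : ε.InCore) (y : Lt.X),
    (η v ν₁ hε.isCross_src).hom.app y ≫ Lt.gammaZeroApp v ε hε y =
      I.gammaOneApp v ε hε y ≫ (η v ν₂ hε.isCross_tgt).hom.app y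

variable {I}
variable {η : ∀ (v : Vmod) (ν : LogVertex (isArc v)) (hν : ν.IsCross),
  Lt.lam v ν ⋙ Lt.forget v ⋙ Lt.toE v ⋙ Lt.monoAn ⋙ Lt.κAnMono.functor ⋙ Lt.ψAnMono v ⟨ν, hν⟩ ≅ Lt.lam v ν ⋙ Lt.monoNplus v}

/-- **Conjugate form.**  The square holds iff, along every edge of `Γ⃗×_v`, the `γ¹`-side homotopy induced by `ι^{An⊢⊞}_{v,ε}`
IS the `η⊢`-conjugate of the mono-analyticised `ι⊞_{v,ε}`: on the image of `γ¹`, `ι^{An⊢⊞}` is determined by `ι⊞` and `η⊢`.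
[cite: MochizukiAbsTopIII2015, Cor 5.10 (iv)(c) p. 148] -/
theorem etaNaturalAt_iff_conj :
    I.EtaNaturalAt η ↔
      ∀ (v : Vmod) ⦃ν₁ ν₂ : LogVertex (isArc v)⦄ (ε : LogEdgeTS (isArc v) ν₁ ν₂) (hε : ε.InCore) (y : Lt.X),
        I.gammaOneApp v ε hε y =
          (η v ν₁ hε.isCross_src).hom.app y ≫ Lt.gammaZeroApp v ε hε y ≫ (η v ν₂ hε.isCross_tgt).inv.app y := by
  constructor
  · intro h v ν₁ ν₂ ε hε y
    rw [← Category.assoc, h v ε hε y, Category.assoc, Iso.hom_inv_id_app, Category.comp_id]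
  · intro h v ν₁ ν₂ ε hε y
    rw [h v ε hε y, Category.assoc, Category.assoc, Iso.inv_hom_id_app, Category.comp_id]

/-- **`η⊢` at the source of an edge of `Γ⃗×_v` is determined by `η⊢` at its target** whenever the mono-analyticised
`ι⊞_{v,ε,y}` is a monomorphism (in print an inclusion `𝒪^× ↪ k̄^×`, `k~ ↪ (k̄^×)^pf`, … of topological modules): two families
satisfying the square for the SAME `ι^{An⊢⊞}`-data and agreeing at `ν₂` agree at `ν₁`.  Since `Γ⃗×_non` (resp. `Γ⃗×_arc`) is
connected with sink `(k̄^×)^pf` (resp. `k^×`), under monic `ι⊞` the family `η⊢_{v,·}` is determined by its value at the sink.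
[cite: MochizukiAbsTopIII2015, Cor 5.10 (iv)(c) p. 148] -/
theorem eta_app_eq_of_mono
    {η' : ∀ (v : Vmod) (ν : LogVertex (isArc v)) (hν : ν.IsCross),
      Lt.lam v ν ⋙ Lt.forget v ⋙ Lt.toE v ⋙ Lt.monoAn ⋙ Lt.κAnMono.functor ⋙ Lt.ψAnMono v ⟨ν, hν⟩ ≅
        Lt.lam v ν ⋙ Lt.monoNplus v}
    (h : I.EtaNaturalAt η) (h' : I.EtaNaturalAt η') (v : Vmod) {ν₁ ν₂ : LogVertex (isArc v)}
    (ε : LogEdgeTS (isArc v) ν₁ ν₂) (hε : ε.InCore) (y : Lt.X) [Mono (Lt.gammaZeroApp v ε hε y)]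
    (h₂ : (η v ν₂ hε.isCross_tgt).hom.app y = (η' v ν₂ hε.isCross_tgt).hom.app y) :
    (η v ν₁ hε.isCross_src).hom.app y = (η' v ν₁ hε.isCross_src).hom.app y := by
  rw [← cancel_mono (Lt.gammaZeroApp v ε hε y), h v ε hε y, h' v ε hε y, h₂]

/-- **Def 5.4 (iii)'s commutativity transfers to the `γ¹`-side.**  Under the square, if the `ι⊞`-components of two
2-chains `ν₁ → ν₂ → ν₃`, `ν₁ → ν₂′ → ν₃` of `Γ⃗×_v` have the same composite at `y` (the commutative square
`𝒪^× ↪ k̄^× → (k̄^×)^pf` / `𝒪^× → k~ ↪ (k̄^×)^pf` of `Γ⃗×_non`; abc-iut-f-101's `IotaSquaresCommute`), then so do the induced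
homotopies `γ¹_{v,ν₁} ⇒ γ¹_{v,ν₂} ⇒ γ¹_{v,ν₃}` and `γ¹_{v,ν₁} ⇒ γ¹_{v,ν₂′} ⇒ γ¹_{v,ν₃}` (both are `η⊢`-conjugates of the common composite).
[cite: MochizukiAbsTopIII2015, Cor 5.10 (iv)(c) p. 148] -/
theorem gammaOneApp_comp_eq (h : I.EtaNaturalAt η) (v : Vmod) {ν₁ ν₂ ν₂' ν₃ : LogVertex (isArc v)}
    (ε₁₂ : LogEdgeTS (isArc v) ν₁ ν₂) (h₁₂ : ε₁₂.InCore) (ε₂₃ : LogEdgeTS (isArc v) ν₂ ν₃) (h₂₃ : ε₂₃.InCore)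
    (ε₁₂' : LogEdgeTS (isArc v) ν₁ ν₂') (h₁₂' : ε₁₂'.InCore) (ε₂'₃ : LogEdgeTS (isArc v) ν₂' ν₃)
    (h₂'₃ : ε₂'₃.InCore) (y : Lt.X)
    (hsq : (Lt.iotaCore v ε₁₂ h₁₂).app y ≫ (Lt.iotaCore v ε₂₃ h₂₃).app y =
      (Lt.iotaCore v ε₁₂' h₁₂').app y ≫ (Lt.iotaCore v ε₂'₃ h₂'₃).app y) :
    I.gammaOneApp v ε₁₂ h₁₂ y ≫ I.gammaOneApp v ε₂₃ h₂₃ y =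
      I.gammaOneApp v ε₁₂' h₁₂' y ≫ I.gammaOneApp v ε₂'₃ h₂'₃ y := by
  have hM : Lt.gammaZeroApp v ε₁₂ h₁₂ y ≫ Lt.gammaZeroApp v ε₂₃ h₂₃ y =
      Lt.gammaZeroApp v ε₁₂' h₁₂' y ≫ Lt.gammaZeroApp v ε₂'₃ h₂'₃ y := by
    have hN := congrArg (Lt.monoNplus v).map hsq
    simp only [Functor.map_comp] at hN
    exact hN
  have hc := (etaNaturalAt_iff_conj (I := I) (η := η)).mp h
  rw [hc v ε₁₂ h₁₂ y, hc v ε₂₃ h₂₃ y, hc v ε₁₂' h₁₂' y, hc v ε₂'₃ h₂'₃ y]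
  simp only [Category.assoc, Iso.inv_hom_id_app_assoc]
  rw [reassoc_of% hM]

end IotaAnMono

namespace MonoTelecoreCoherence

variable {Lt} {M : Lt.MonoAnalyticizationHomotopies} (K : Lt.MonoTelecoreCoherence M)

/-- **The square over the coherence add-on**: for `K : MonoTelecoreCoherence L M` (printed `η⊢_{v,ν}` = `K.eta`) and
`ι^{An⊢⊞}`-data `I` over `K.psiOver`, `K.EtaNatural I` is the `η⊢`-naturality square for `K.eta` — the edge-indexed coherence
datum of print's single family `ℋ_{An⊢} ∪ S_log⊞ ∪ …` of Cor 5.10 (iv)(c) ("compatible").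
[cite: MochizukiAbsTopIII2015, Cor 5.10 (iv)(c) p. 148] -/
def EtaNatural (I : K.IotaData) : Prop :=
  IotaAnMono.EtaNaturalAt I K.eta

end MonoTelecoreCoherence

/-! ## Non-vacuity (DEGENERATE, calibration only): the tagged setting -/

variable (Vmod isArc)
variable (C : Type (u + 1)) [Category.{u} C]

/-- At the tagged setting the untwisted `ι⊞_{v,ε}` along an edge of `Γ⃗×_v` is `(𝟙, tag ν₁ ≤ tag ν₂)` (the cast is an identity).
[cite: MochizukiAbsTopIII2015, Def 5.4 (vii) p. 128] -/
theorem taggedLt_iotaCore (v : Vmod) {ν₁ ν₂ : LogVertex (isArc v)} (ε : LogEdgeTS (isArc v) ν₁ ν₂)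
    (hε : ε.InCore) :
    (taggedLt Vmod isArc C).iotaCore v ε hε =
      NatTrans.prod' (𝟙 (𝟭 C)) ((Functor.const C).map (homOfLE (unitTag_le_ltimes hε.toLogEdgeLtimes))) :=
  (taggedLt Vmod isArc C).iotaPre_eq_of_iota_eq v hε.toLogEdgeLtimes hε.isCross_src.1 _ rfl

/-- **`ι^{An⊢⊞}`-data at the TAGGED setting** over its coherence add-on `taggedMonoTelecoreCoherence` (`ψ` over `ℰ⊢` by
identities): `ι^{An⊢⊞}_{w,ε} := (𝟙, tag ν₁ ≤ tag ν₂)`, the same recipe as the tagged `ι⊞_{v,ε}`; it lies over `Th⊢[Z]` on the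
nose.  Calibration device, no arithmetic content. [cite: MochizukiAbsTopIII2015, Prop 5.8 (vii) p. 142] -/
def taggedLtIotaAnMono :
    (taggedLt Vmod isArc C).IotaAnMono (taggedLtMonoTelecoreCoherence Vmod isArc C).psiOver where
  ι _ _ _ _ hε := NatTrans.prod' (𝟙 (𝟭 C)) ((Functor.const C).map (homOfLE (unitTag_le_ltimes hε.toLogEdgeLtimes)))
  ι_over w ν₁ ν₂ ε hε X := by
    change 𝟙 X = 𝟙 X ≫ 𝟙 X
    rw [Category.comp_id]

/-- Along `𝒪^× ↪ k̄^×` (tags `0 → 1`) the tagged `ι^{An⊢⊞}_{w,ε}` is NOT an isomorphism at any object: the witness below is not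
the all-identities one. [cite: MochizukiAbsTopIII2015, Prop 5.8 (vii) p. 142] -/
theorem taggedLtIotaAnMono_not_isIso (w : Vmod) (hw : isArc w = false) (X : C) :
    ∃ (ν₁ ν₂ : LogVertex (isArc w)) (ε : LogEdgeTS (isArc w) ν₁ ν₂) (hε : ε.InCore),
      ¬ IsIso (((taggedLtIotaAnMono Vmod isArc C).ι w ε hε).app X) := by
  obtain ⟨ν₁, ν₂, ε, hε, h0, h1⟩ := exists_inCore_unitTag (isArc w) hw
  refine ⟨ν₁, ν₂, ε, hε, fun hI => ?_⟩
  have e : ((X, unitTag ν₁) : C × Fin 2) ≅ (X, unitTag ν₂) :=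
    @asIso _ _ _ _ (((taggedLtIotaAnMono Vmod isArc C).ι w ε hε).app X) hI
  have e₁ : (unitTag ν₁ : Fin 2) ≅ unitTag ν₂ := (CategoryTheory.Prod.snd C (Fin 2)).mapIso e
  have h01 := e₁.to_eq
  rw [h0, h1] at h01
  exact absurd h01 (by decide)

/-- **The square HOLDS at the tagged setting** (every `η⊢_{v,ν}` the identity, `ι⊞ = ι^{An⊢⊞} = (𝟙, tag ν₁ ≤ tag ν₂)`): both
composites are `(𝟙, tag ν₁ ≤ tag ν₂)` — the `Fin 2`-components agree because `Fin 2` is a poset.  DEGENERATE consistency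
witness: `EtaNatural` is jointly satisfiable with the coherence add-on and with non-invertible `ι`'s.
[cite: MochizukiAbsTopIII2015, Cor 5.10 (iv)(c) p. 148] -/
theorem taggedLt_etaNatural :
    (taggedLtMonoTelecoreCoherence Vmod isArc C).EtaNatural (taggedLtIotaAnMono Vmod isArc C) := by
  intro v ν₁ ν₂ ε hε y
  unfold IotaAnMono.gammaOneApp gammaZeroApp
  rw [taggedLt_iotaCore]
  apply Prod.hom_ext
  · -- first components: identities of `y` throughout (`λ⊞`, `ψ^{An⊢⊞}` are `(𝟭, tag)`, every 2-cell is `(𝟙, ≤)`)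
    change 𝟙 y ≫ 𝟙 y = (𝟙 y ≫ 𝟙 y) ≫ 𝟙 y
    simp only [Category.comp_id]
  · exact Subsingleton.elim _ _

/-- Hence, over every index set: a setting carrying the mono-analyticization homotopies, the coherence add-on
`MonoTelecoreCoherence` (printed `η⊢`) AND `ι^{An⊢⊞}`-data over it satisfying the `η⊢`-naturality square — the data half of
the strengthened Cor 5.10 (iv)(c) row is jointly satisfiable (degenerate witness).
[cite: MochizukiAbsTopIII2015, Cor 5.10 (iv)(c) p. 148] -/
theorem exists_monoTelecoreCoherence_etaNatural :
    ∃ (Lt : LogFrobeniusSettingLtimes Vmod isArc) (M : Lt.MonoAnalyticizationHomotopies) (K : Lt.MonoTelecoreCoherence M)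
      (I : K.IotaData), K.EtaNatural I :=
  ⟨taggedLt Vmod isArc (Type u), taggedLtMonoHomotopies Vmod isArc (Type u),
    taggedLtMonoTelecoreCoherence Vmod isArc (Type u), taggedLtIotaAnMono Vmod isArc (Type u),
    taggedLt_etaNatural Vmod isArc (Type u)⟩

end LogFrobeniusSettingLtimes

end Literature.AnabelianGeometry.AbsoluteAnabelian
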